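import Literature.Barriers.QuantumAdvantage.AaronsonChenThm51SampBQPSubsetHolds
import Literature.Barriers.QuantumAdvantage.SampPRelSubsetSampBQPRelHolds
import HarnessLib

/-!
# Aaronson–Chen 2017, Thm. 5.1 (sampling bullet): `SampBPP^{TQBF,O} = SampBQP^{TQBF,O}` with probability `1` — the discharge

Proof file (D-0014: theorems only, no definitions, no named facts; net debt −1) closing the named
fact `aaronsonChen2017_thm51_samp` of `AaronsonChenOracle.lean`, which vendors

* S. Aaronson, L. Chen, *Complexity-theoretic foundations of quantum supremacy experiments*,
  CCC 2017, LIPIcs 79, 22:1–22:67 (doi:10.4230/LIPIcs.CCC.2017.22; arXiv:1612.05903)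
  [AaronsonChen2017], **Theorem 5.1, first bullet** (p. 21): "For an oracle `O` drawn from `𝒟_O`,
  the following statements hold with probability `1`: • `SampBPP^{TQBF,O} = SampBQP^{TQBF,O}`."

in the tree's models: `∀ᵐ O ∂acOracleMeasure, SampPRel (Oracle.ofLanguage (TQBF ⊕ O)) = SampBQPRel (TQBF ⊕ O)`.

The printed proof (p. 21) has two halves, both now theorems of the tree:

* `SampBQP^{TQBF,O} ⊆ SampBPP^{TQBF,O}` with probability `1` — from **Lemma 5.3** (the
  `SampBPP^{TQBF,O}` simulation, `ε`-close with probability `≥ 1 − exp(−(2|x| + 1/ε))`; discharged as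
  `aaronsonChen2017_lem53_holds`, `AaronsonChenLem53Holds.lean`: hybrid/BBBV replacement analysis,
  posterior-Chernoff bound, the PPT `TQBF ⊕ O` adversary, its advice language in `PSPACE`, the
  `PSPACE`-completeness of `TQBF`) by the a.s. glue "the expected number of bad pairs `(x, ε)` is
  `O(1)` … only finitely many bad pairs with probability 1 … hardwire them … countably many `SampBQP`
  algorithms … run `A_M` at accuracy `ε/2`" (`aaronsonChen2017_thm51_sampBQP_subset_of_lem53`,
  `AaronsonChenOracleProofs.lean`), composed as `aaronsonChen2017_thm51_sampBQP_subset_holds`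
  (`AaronsonChenThm51SampBQPSubsetHolds.lean`);
* the trivial inclusion `SampBPP^A ⊆ SampBQP^A` for every oracle `A` (tacit in the paper; Def. 2.3):
  `SampPRel_subset_SampBQPRel_holds` (`SampPRelSubsetSampBQPRelHolds.lean`, from the relativized
  uniform reversible simulation `uniformOracleCoinSimulation_holds` through
  `SampPRel_subset_SampBQPRel_of_sim`, `SampPRelSubsetSampBQPRel.lean`).

The two are put together by `aaronsonChen2017_thm51_samp_of` (`AaronsonChenOracle.lean`:
`Filter.Eventually.mono` and antisymmetry of `⊆`).

## References

* [AaronsonChen2017] arXiv:1612.05903 / LIPIcs.CCC.2017.22 (held; read via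
  `lit read arxiv:1612.05903 --pages 20-24`): Thm. 5.1 (p. 21, first bullet), its proof from
  Lemma 5.3 (p. 21), Lemma 5.3 (p. 21; proof §5.3, pp. 21–23), Def. 2.3 (oracle sampling classes).
-/

namespace Literature.Barriers.QuantumAdvantage

/-- **Aaronson–Chen 2017, Thm. 5.1, first bullet — DISCHARGED**: for `O ∼ 𝒟_O`, with probability
`1`, `SampBPP^{TQBF,O} = SampBQP^{TQBF,O}`; in the tree's models
`∀ᵐ O ∂acOracleMeasure, SampPRel (Oracle.ofLanguage (TQBF ⊕ O)) = SampBQPRel (TQBF ⊕ O)`.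
Proof, as printed (p. 21): the almost-sure inclusion `SampBQP ⊆ SampBPP` relative to `TQBF ⊕ O`
(`aaronsonChen2017_thm51_sampBQP_subset_holds`, from Lemma 5.3 by Borel–Cantelli over the bad pairs,
hard-wiring, countably many algorithms, accuracy halving) and the trivial inclusion
`SampBPP^A ⊆ SampBQP^A` (`SampPRel_subset_SampBQPRel_holds`), combined pointwise on the
probability-one event (`aaronsonChen2017_thm51_samp_of`).
[cite: AaronsonChen2017, Thm. 5.1 (p. 21, first bullet; proof p. 21 from Lemma 5.3, pp. 21–23)] -/
theorem aaronsonChen2017_thm51_samp_holds : aaronsonChen2017_thm51_samp :=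
  aaronsonChen2017_thm51_samp_of aaronsonChen2017_thm51_sampBQP_subset_holds
    SampPRel_subset_SampBQPRel_holds

end Literature.Barriers.QuantumAdvantage
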